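import Literature.Geometry.Riemannian.HeatGradientSubsolution
import Literature.Geometry.Riemannian.ToppingEntropyIntegrand
import Literature.Geometry.Riemannian.RicciFlowChartMetricBounds
import Literature.Geometry.Riemannian.RicciFlowMetricLimit
import Literature.Geometry.Riemannian.PerelmanEntropyNoncollapsing
import Literature.Geometry.Riemannian.ConjugateHeatConservation
import Literature.Geometry.Lorentzian.CoordConjugateHeat
import HarnessLib

/-!
# The Bernstein–Shi interior gradient estimate for the conjugate heat equation on a Ricci flow

Let `(h, cov)` be a Ricci flow of Riemannian metrics on `[s, t₁]` on a closed manifold modelled on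
`ℝ^m`, with bounded curvature `|Rm| ≤ Λ` (frame sense, `CurvatureBoundedBy`) and bounded gradient
of the scalar curvature `|∇R|² ≤ Λ'²`, and let `v` be a smooth solution of the **conjugate heat
equation** `∂ᵣv = −Δ_{h(r)} v + R v` on `M × [s, t₁]` (`IsConjugateHeatSolutionOn`,
`ToppingEntropyIntegrand.lean`; e.g. `y ↦ K(x, t; y, r)`, the conjugate heat kernel in its second
pair of variables). The classical Bernstein–Shi device — apply the maximum principle to
`G = (t₁ − r)|∇v|² + A v²` — gives the scale-invariant interior (in time) gradient bound

  `(t₁ − s) |∇v|²(·, s) ≤ C(m, Λ(t₁ − s), Λ'²(t₁ − s)³) · sup_{M × [s, t₁]} v²`,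

the a-priori regularity input of Gaussian bounds for the conjugate heat kernel (Bamler 2020a,
proof of Thm. 7.2: the flow-dependent constant `C* < ∞` of display (7.17), imported there from
Chow et al., Part III). Everything here is PROVED:

* Part A (coordinates, `MetricCoord.IsMetricFamilyOn.hasDerivWithinAt_gradSqAt_of_conjHeat`):
  along a coordinate Ricci flow `∂G/∂t = −2Ric(G)`, for `v` solving `∂ₜv = −Δv + Rv`,
  `∂ₜ|∇v|² = −Δ|∇v|² + 2|Hess v|² + 4Ric(∇v,∇v) + 2v⟨∇R,∇v⟩ + 2R|∇v|²` (the flow's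
  `∂ₜ|∇v|² = 2Ric(∇v,∇v) + 2⟨∇v̇,∇v⟩`, `hasDerivWithinAt_gradSqAt_ricciFlow`,
  `CoordEntropyEvolution.lean`, and Bochner's formula `IsMetricOn.lapAt_gradSqAt`,
  `CoordBochner.lean`), whence (`bernstein_conjHeat_ge`) the pointwise inequality
  `(∂ₜ + Δ)[(t₁ − t)|∇v|² + A v²] ≥ −(T²L + 2AC_S) v²` under `Ric ≥ −C_R`, `R ≥ −C_S`,
  `|∇R|² ≤ L`, `A ≥ 1 + T(2C_R + C_S)`;
* Part B (manifold, `IsRicciFlow.bernstein_conjugateHeat_ge`): the same inequality for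
  `G = (t₁ − r)|∇v|²_{h(r)} + A v²` on `M × [s, t₁]`, transported through the chart at a point
  exactly as `derivWithin_gradSq_le_of_heat_ricciFlow` (`HeatGradientSubsolution.lean`), with
  `|Ric(X,X)| ≤ mΛ|X|²` (`CurvatureBoundedBy.abs_ricci_le`) and `|R| ≤ m²Λ`
  (`abs_scalarCurvatureWith_le_of_curvatureBoundedOn`);
* Part C (`exists_conjugateHeat_mul_gradSq_le`): the time-reversed `σ ↦ G(t₁ − σ)` is a
  subsolution of `∂_σ u ≤ Δ_{h(t₁−σ)} u + K₁ u` on `[0, t₁ − s]`, and Topping's weak maximum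
  principle (`weakMaximumPrinciple`, which requires nothing of the metric family) bounds it by
  `A B² e^{K₁ σ}`.

## References

* P. Topping, *Lectures on the Ricci flow*, LMS Lecture Note Series 325, CUP 2006, Thm. 3.1.1
  (weak maximum principle), proof of Prop. 8.2.6 (Bochner formula under the flow), §6.3
  (the conjugate heat operator). [Topping2006]
* W.-X. Shi, *Deforming the metric on complete Riemannian manifolds*, J. Differential Geom. 30
  (1989), 223–301 (the Bernstein device `F = t|∇T|² + A|T|²` of the derivative estimates).
* R. H. Bamler, *Entropy and heat kernel bounds on a Ricci flow background*, arXiv:2008.07093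
  (2020), §7, proof of Thm. 7.2. [Bamler2020Entropy]
* B. O'Neill, *Semi-Riemannian geometry with applications to relativity*, Academic Press 1983,
  Ch. 3, Prop. 3.59 (local isometries), Lemma 3.52, Def. 3.53. [ONeill1983]
-/

noncomputable section

set_option maxSynthPendingDepth 3

open Set Filter Function Module
open scoped Topology ContDiff Manifold

/-! ## Part A — the evolution of `|∇v|²` and of `G = (t₁ − t)|∇v|² + A v²` in coordinates -/

namespace Literature.Geometry.Lorentzian

namespace MetricCoord

section SharpPositivity

variable {E : Type*} [NormedAddCommGroup E] [NormedSpace ℝ E] {G : E → E →L[ℝ] E →L[ℝ] ℝ} {x : E}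

/-- **Weighted Cauchy–Schwarz for the inverse metric** (AM–GM): for positive semidefinite
symmetric invertible `G x`, covectors `α, β` and `c : ℝ`, `2c α(♯β) ≥ −(c² α(♯α) + β(♯β))`
(expand `0 ≤ (cα + β)(♯(cα + β))`). [folklore] -/
theorem neg_le_two_mul_apply_sharpAt (hi : (G x).IsInvertible) (hs : ∀ v w : E, G x v w = G x w v)
    (hpos : ∀ e : E, 0 ≤ G x e e) (α β : E →L[ℝ] ℝ) (c : ℝ) :
    -(c ^ 2 * α (sharpAt G x α) + β (sharpAt G x β)) ≤ 2 * c * α (sharpAt G x β) := by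
  have h := apply_sharpAt_self_nonneg hi hpos (c • α + β)
  have hswap : β (sharpAt G x α) = α (sharpAt G x β) := by
    rw [← apply_sharpAt_apply hi β (sharpAt G x α), hs, apply_sharpAt_apply hi]
  have hexp : (c • α + β) (sharpAt G x (c • α + β)) =
      c ^ 2 * α (sharpAt G x α) + 2 * c * α (sharpAt G x β) + β (sharpAt G x β) := by
    simp only [map_add, map_smul, _root_.add_apply, _root_.smul_apply, smul_eq_mul]
    rw [hswap]
    ring
  rw [hexp] at h
  linarith

end SharpPositivity

namespace IsMetricFamilyOn

variable {E : Type*} [NormedAddCommGroup E] [NormedSpace ℝ E] [FiniteDimensional ℝ E]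
  [CompleteSpace E] {G : ℝ → E → E →L[ℝ] E →L[ℝ] ℝ} {S : Set ℝ} {V : Set E} {x : E} {t : ℝ}
  {v : ℝ → E → ℝ} {Rc : E → ℝ}

variable (hG : IsMetricFamilyOn G S V)
  (hfl : ∀ s ∈ S, ∀ y ∈ V, tDeriv G S s y = (-2 : ℝ) • ricAt (G s) y)
include hG hfl

/-- **The evolution of `|∇v|²` for a solution of the conjugate heat equation along a coordinate
Ricci flow.** Let `G` be a smooth family of metric components on `V × S` solving
`∂G/∂t = −2 Ric(G)` and `v`, `C^∞` on `V × S`, solve at time `t` on `V` the conjugate heat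
equation `∂ₜv = −Δ_{G t} v + R v` with a `C^∞` coefficient `R` (the scalar curvature). Then at
`x ∈ V`, with `♯Dv` the gradient,

  `∂ₜ|∇v|² = −Δ|∇v|² + 2|Hess v|² + 4 Ric(♯Dv, ♯Dv) + 2 v DR(♯Dv) + 2 R |∇v|²`

(`∂ₜ|∇v|² = 2Ric(∇v,∇v) + 2 Dv̇(♯Dv)` under the flow, `hasDerivWithinAt_gradSqAt_ricciFlow`;
`Dv̇ = −D(Δv) + v DR + R Dv`; and Bochner `Δ|∇v|² = 2|Hess v|² + 2D(Δv)(♯Dv) + 2Ric(∇v,∇v)`,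
`lapAt_gradSqAt`). [cite: Topping2006, proof of Prop. 8.2.6 (Bochner formula under the flow)] -/
theorem hasDerivWithinAt_gradSqAt_of_conjHeat
    (hv : ContDiffOn ℝ ∞ (fun p : E × ℝ ↦ v p.2 p.1) (V ×ˢ S)) (hRc : ContDiffOn ℝ ∞ Rc V)
    (hx : x ∈ V) (ht : t ∈ S)
    (hveq : ∀ y ∈ V, tDerivFun v S t y = -lapAt (G t) (v t) y + Rc y * v t y) :
    HasDerivWithinAt (fun s ↦ gradSqAt (G s) (v s) x)
      (-lapAt (G t) (gradSqAt (G t) (v t)) x + 2 * normSqAt (G t) x (hessAt (G t) (v t) x)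
        + 4 * ricAt (G t) x (sharpAt (G t) x (fderiv ℝ (v t) x))
            (sharpAt (G t) x (fderiv ℝ (v t) x))
        + 2 * v t x * fderiv ℝ Rc x (sharpAt (G t) x (fderiv ℝ (v t) x))
        + 2 * Rc x * gradSqAt (G t) (v t) x) S t := by
  have hGt := hG.isMetricOn t ht
  have hVo : IsOpen V := hG.isOpen ht
  have hvt : ContDiffOn ℝ ∞ (v t) V := contDiffOn_of_family hv ht
  -- `D v̇ = D(−Δv + R v)` at `x` (the equation holds on the neighbourhood `V` of `x`)
  have hweq : tDerivFun v S t =ᶠ[𝓝 x] fun y ↦ -lapAt (G t) (v t) y + Rc y * v t y := by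
    filter_upwards [hVo.mem_nhds hx] with y hy using hveq y hy
  have hΔd : DifferentiableAt ℝ (lapAt (G t) (v t)) x :=
    (contDiffAt_of_contDiffOn hVo (hGt.contDiffOn_lapAt hvt) hx).differentiableAt (by simp)
  have hRd : DifferentiableAt ℝ Rc x :=
    (contDiffAt_of_contDiffOn hVo hRc hx).differentiableAt (by simp)
  have hvd : DifferentiableAt ℝ (v t) x :=
    (contDiffAt_of_contDiffOn hVo hvt hx).differentiableAt (by simp)
  have hD : fderiv ℝ (tDerivFun v S t) x =
      -fderiv ℝ (lapAt (G t) (v t)) x + (Rc x • fderiv ℝ (v t) x + v t x • fderiv ℝ Rc x) := by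
    rw [hweq.fderiv_eq]
    exact (hΔd.hasFDerivAt.neg.add (hRd.hasFDerivAt.mul hvd.hasFDerivAt)).fderiv
  have hB := hGt.lapAt_gradSqAt hx hvt
  refine (hG.hasDerivWithinAt_gradSqAt_ricciFlow hfl hv hx ht).congr_deriv ?_
  rw [hD, hB, gradSqAt_apply]
  simp only [_root_.add_apply, _root_.neg_apply, _root_.smul_apply, smul_eq_mul]
  ring

/-- **The Bernstein–Shi quantity `G = (t₁ − t)|∇v|² + A v²` for the conjugate heat equation, in
coordinates.** Under the hypotheses of `hasDerivWithinAt_gradSqAt_of_conjHeat`, suppose moreover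
that `G t x` is positive definite, `Ric(G t)(x) ≥ −C_R G t x`, `R(x) ≥ −C_S`, `|∇R|²(x) ≤ L`,
`t ≤ t₁`, `0 ≤ t₁ − t ≤ T`, and `A ≥ 1 + T(2C_R + C_S)`. Then at `x`

  `(∂ₜ + Δ) [(t₁ − t)|∇v|² + A v²] ≥ −(T² L + 2 A C_S) v²`

(from `(∂ₜ + Δ)|∇v|² = 2|Hess v|² + 4Ric(∇v,∇v) + 2v⟨∇R,∇v⟩ + 2R|∇v|²`,
`(∂ₜ + Δ)v² = 2Rv² + 2|∇v|²`, `|Hess v|² ≥ 0`, and the weighted Cauchy–Schwarz inequality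
`2(t₁ − t) v⟨∇R,∇v⟩ ≥ −(t₁ − t)² v²|∇R|² − |∇v|²`). This is the computation of Shi's
derivative estimate (Shi 1989, the device `F = t|∇T|² + A|T|²`) for the scalar backward equation.
[cite: Topping2006, proof of Prop. 8.2.6 (Bochner formula under the flow)] -/
theorem bernstein_conjHeat_ge
    (hv : ContDiffOn ℝ ∞ (fun p : E × ℝ ↦ v p.2 p.1) (V ×ˢ S)) (hRc : ContDiffOn ℝ ∞ Rc V)
    (hx : x ∈ V) (ht : t ∈ S)
    (hveq : ∀ y ∈ V, tDerivFun v S t y = -lapAt (G t) (v t) y + Rc y * v t y)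
    (hposdef : ∀ e : E, e ≠ 0 → 0 < G t x e e)
    {CR CS L T A t₁ : ℝ} (hCR : 0 ≤ CR) (hCS : 0 ≤ CS)
    (hRic : ∀ e : E, -(CR * G t x e e) ≤ ricAt (G t) x e e) (hRlo : -CS ≤ Rc x)
    (hDR : gradSqAt (G t) Rc x ≤ L) (htt₁ : t ≤ t₁) (ht₁T : t₁ - t ≤ T)
    (hA : 1 + T * (2 * CR + CS) ≤ A) :
    -((T ^ 2 * L + 2 * A * CS) * (v t x) ^ 2) ≤
      tDerivFun (fun s y ↦ (t₁ - s) * gradSqAt (G s) (v s) y + A * (v s y) ^ 2) S t x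
        + lapAt (G t) (fun y ↦ (t₁ - t) * gradSqAt (G t) (v t) y + A * (v t y) ^ 2) x := by
  have hGt := hG.isMetricOn t ht
  have hVo : IsOpen V := hG.isOpen ht
  have hvt : ContDiffOn ℝ ∞ (v t) V := contDiffOn_of_family hv ht
  have hi := hGt.isInvertible x hx
  have hs := hGt.symm x hx
  have hpos' : ∀ e : E, 0 ≤ G t x e e := fun e ↦ by
    by_cases he : e = 0
    · rw [he]; simp
    · exact (hposdef e he).le
  -- (1) the time derivatives of `|∇v|²`, `v`, `v²` and of `G`
  have hW := hG.hasDerivWithinAt_gradSqAt_of_conjHeat hfl hv hRc hx ht hveq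
  have hV : HasDerivWithinAt (fun s ↦ v s x) (-lapAt (G t) (v t) x + Rc x * v t x) S t := by
    have h := hasDerivWithinAt_of_family hv hx ht
    rwa [hveq x hx] at h
  have hV2 : HasDerivWithinAt (fun s ↦ (v s x) ^ 2)
      (2 * v t x * (-lapAt (G t) (v t) x + Rc x * v t x)) S t := by
    refine (hV.fun_pow 2).congr_deriv ?_
    simp only [Nat.cast_ofNat, Nat.add_one_sub_one, pow_one]
  have ha' : HasDerivWithinAt (fun s ↦ t₁ - s) (-1) S t := by
    simpa using (hasDerivWithinAt_id t S).const_sub t₁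
  have e1 : tDerivFun (fun s y ↦ (t₁ - s) * gradSqAt (G s) (v s) y + A * (v s y) ^ 2) S t x =
      -1 * gradSqAt (G t) (v t) x + (t₁ - t) *
        (-lapAt (G t) (gradSqAt (G t) (v t)) x + 2 * normSqAt (G t) x (hessAt (G t) (v t) x)
          + 4 * ricAt (G t) x (sharpAt (G t) x (fderiv ℝ (v t) x))
            (sharpAt (G t) x (fderiv ℝ (v t) x))
          + 2 * v t x * fderiv ℝ Rc x (sharpAt (G t) x (fderiv ℝ (v t) x))
          + 2 * Rc x * gradSqAt (G t) (v t) x)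
        + A * (2 * v t x * (-lapAt (G t) (v t) x + Rc x * v t x)) :=
    ((ha'.mul hW).add (hV2.const_mul A)).derivWithin (hG.uniqueDiffOn t ht)
  -- (2) the Laplacian of `G t`
  have h2w : ContDiffAt ℝ 2 (gradSqAt (G t) (v t)) x :=
    contDiffAt_two_of_contDiffOn hVo (hGt.contDiffOn_gradSqAt hvt) hx
  have h2v : ContDiffAt ℝ 2 (v t) x := contDiffAt_two_of_contDiffOn hVo hvt hx
  have h2v2 : ContDiffAt ℝ 2 (fun y ↦ (v t y) ^ 2) x := h2v.pow 2
  have hsq : lapAt (G t) (fun y ↦ (v t y) ^ 2) x =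
      2 * v t x * lapAt (G t) (v t) x + 2 * gradSqAt (G t) (v t) x := by
    simp only [sq]
    rw [lapAt_mul (G t) hi hs h2v h2v, gradSqAt_apply]
    ring
  have e2 : lapAt (G t) (fun y ↦ (t₁ - t) * gradSqAt (G t) (v t) y + A * (v t y) ^ 2) x =
      (t₁ - t) * lapAt (G t) (gradSqAt (G t) (v t)) x
        + A * (2 * v t x * lapAt (G t) (v t) x + 2 * gradSqAt (G t) (v t) x) := by
    rw [lapAt_add (G t) (contDiffAt_const.mul h2w) (contDiffAt_const.mul h2v2),
      lapAt_const_mul (G t) h2w, lapAt_const_mul (G t) h2v2, hsq]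
  rw [e1, e2]
  -- (3) abbreviations for the scalars at `(x, t)`
  have hwφ : gradSqAt (G t) (v t) x =
      fderiv ℝ (v t) x (sharpAt (G t) x (fderiv ℝ (v t) x)) := rfl
  rw [hwφ]
  set φ : E →L[ℝ] ℝ := fderiv ℝ (v t) x with hφ
  set ρ : E →L[ℝ] ℝ := fderiv ℝ Rc x with hρ
  set w : ℝ := φ (sharpAt (G t) x φ) with hw
  set vt : ℝ := v t x with hvt_def
  set a : ℝ := t₁ - t with ha
  set Hn : ℝ := normSqAt (G t) x (hessAt (G t) (v t) x) with hHn
  set Rv : ℝ := ricAt (G t) x (sharpAt (G t) x φ) (sharpAt (G t) x φ) with hRv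
  set P : ℝ := ρ (sharpAt (G t) x φ) with hP
  set Δv : ℝ := lapAt (G t) (v t) x with hΔv
  set Δw : ℝ := lapAt (G t) (gradSqAt (G t) (v t)) x with hΔw
  -- (4) the estimates
  have ha0 : 0 ≤ a := sub_nonneg.2 htt₁
  have hT0 : 0 ≤ T := ha0.trans ht₁T
  have hw0 : 0 ≤ w := apply_sharpAt_self_nonneg hi hpos' φ
  have hHn0 : 0 ≤ Hn := normSqAt_nonneg_of_posDef hs hposdef _
  have hRv' : -(CR * w) ≤ Rv := by
    have h := hRic (sharpAt (G t) x φ)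
    rwa [apply_sharpAt_apply hi] at h
  have hρρ : ρ (sharpAt (G t) x ρ) ≤ L := hDR
  have hL0 : 0 ≤ L := (apply_sharpAt_self_nonneg hi hpos' ρ).trans hρρ
  have hA0 : 0 ≤ A := by
    have h : 0 ≤ T * (2 * CR + CS) := mul_nonneg hT0 (by linarith)
    linarith
  -- Cauchy–Schwarz with the weight `c = a vt`
  have hCS' : -((a * vt) ^ 2 * ρ (sharpAt (G t) x ρ) + w) ≤ 2 * (a * vt) * P :=
    neg_le_two_mul_apply_sharpAt hi hs hpos' ρ φ (a * vt)
  have p1 : a * (-(CR * w)) ≤ a * Rv := mul_le_mul_of_nonneg_left hRv' ha0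
  have p2 : a * (CR * w) ≤ T * (CR * w) := mul_le_mul_of_nonneg_right ht₁T (mul_nonneg hCR hw0)
  have p3 : (a * vt) ^ 2 * ρ (sharpAt (G t) x ρ) ≤ T ^ 2 * vt ^ 2 * L := by
    have h1 : (a * vt) ^ 2 * ρ (sharpAt (G t) x ρ) ≤ (a * vt) ^ 2 * L :=
      mul_le_mul_of_nonneg_left hρρ (sq_nonneg _)
    have h2 : a ^ 2 ≤ T ^ 2 := pow_le_pow_left₀ ha0 ht₁T 2
    have h3 : a ^ 2 * (vt ^ 2 * L) ≤ T ^ 2 * (vt ^ 2 * L) :=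
      mul_le_mul_of_nonneg_right h2 (mul_nonneg (sq_nonneg _) hL0)
    calc (a * vt) ^ 2 * ρ (sharpAt (G t) x ρ) ≤ (a * vt) ^ 2 * L := h1
      _ = a ^ 2 * (vt ^ 2 * L) := by ring
      _ ≤ T ^ 2 * (vt ^ 2 * L) := h3
      _ = T ^ 2 * vt ^ 2 * L := by ring
  have p4 : a * (-CS * w) ≤ a * (Rc x * w) :=
    mul_le_mul_of_nonneg_left (mul_le_mul_of_nonneg_right hRlo hw0) ha0
  have p5 : a * (CS * w) ≤ T * (CS * w) := mul_le_mul_of_nonneg_right ht₁T (mul_nonneg hCS hw0)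
  have p6 : A * (-CS * vt ^ 2) ≤ A * (Rc x * vt ^ 2) :=
    mul_le_mul_of_nonneg_left (mul_le_mul_of_nonneg_right hRlo (sq_nonneg vt)) hA0
  have p7 : (1 + T * (2 * CR + CS)) * w ≤ A * w := mul_le_mul_of_nonneg_right hA hw0
  have p8 : 0 ≤ a * Hn := mul_nonneg ha0 hHn0
  linarith [p1, p2, p3, p4, p5, p6, p7, p8, hCS']

end IsMetricFamilyOn

end MetricCoord

end Literature.Geometry.Lorentzian

/-! ## Part B — the differential inequality for `G = (t₁ − t)|∇v|² + A v²` on the manifold -/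

namespace Literature.Geometry.Riemannian

open Lorentzian Lorentzian.PseudoRiemannianMetric

section Pointwise

variable {E : Type*} [NormedAddCommGroup E] [NormedSpace ℝ E] [FiniteDimensional ℝ E]
  [CompleteSpace E] {H : Type*} [TopologicalSpace H] {I : ModelWithCorners ℝ E H} [I.Boundaryless]
  {M : Type*} [TopologicalSpace M] [ChartedSpace H M] [IsManifold I ∞ M]
  {g : ℝ → PseudoRiemannianMetric I ∞ E (TangentSpace I : M → Type _)}
  {cov : ℝ → CovariantDerivative I E (TangentSpace I : M → Type _)}

/-- **The coordinate scalar curvature of the chart representative is the scalar curvature**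
(`IsRicciFlow.scalAt_chartRep_eq` on a general time set): `scalAt (chartRep I g x₀ s) u =
R_{g(s)}(Φ u)` for `s ∈ S`, `R = scalarCurvatureWith (cov s)` (naturality `scalarCurvature_comap`
and `OpensChart.scalarCurvature_eq_scalAt`; `cov s` is Levi-Civita).
[cite: ONeill1983, Ch. 3, Prop. 3.59] -/
theorem IsRicciFlow.scalAt_chartRep_eq_of_mem {S : Set ℝ} (hflow : IsRicciFlow g cov S) (x₀ : M)
    {s : ℝ} (hs : s ∈ S) (u : chartTarget I x₀) :
    MetricCoord.scalAt (chartRep I g x₀ s) u =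
      (g s).scalarCurvatureWith (cov s) (chartInv I x₀ u) := by
  haveI := (g s).hasLeviCivita
  haveI := (chartPullback I (g s) x₀).hasLeviCivita
  have h2 : (2 : ℕ∞ω) ≤ ∞ := WithTop.coe_le_coe.mpr le_top
  rw [← Lorentzian.OpensChart.scalarCurvature_eq_scalAt (val_chartPullback_eq_chartRep g x₀ s) u,
    (g s).scalarCurvature_comap contMDiff_pullbackBilin_holds (contMDiff_chartInv x₀)
      (injective_mfderiv_chartInv x₀) rfl u,
    scalarCurvatureWith, (hflow.isLeviCivita s hs).ricci_eq_ricci h2]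
  rfl

/-- **The differential inequality of the Bernstein–Shi quantity for the conjugate heat equation
on a manifold.** Let `(g, cov)` be a Ricci flow of Riemannian metrics on `[s₀, t₁]`, `s₀ < t₁`,
on a manifold with boundaryless finite-dimensional model (no compactness needed), with
`|Rm| ≤ Λ` (frame sense, `CurvatureBoundedBy`) and `|∇R|² ≤ L` on `M × [s₀, t₁]`, and let `v`
be a smooth solution of the conjugate heat equation `∂ₜv = −Δv + Rv` there
(`IsConjugateHeatSolutionOn`). Put `n = dim M`, `T = t₁ − s₀` and let `A ≥ 1 + T(2nΛ + n²Λ)`.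
Then at every `(y, r) ∈ M × [s₀, t₁]`, for `G = (t₁ − r)|∇v|² + A v²`,

  `∂ₜG + Δ_{g(r)} G ≥ −(T² L + 2 A n² Λ) v²`

(read the flow, `v` and `R` in the chart at `y` and apply
`MetricCoord.IsMetricFamilyOn.bernstein_conjHeat_ge`, with `Ric ≥ −nΛ g`
(`CurvatureBoundedBy.abs_ricci_le`) and `R ≥ −n²Λ`
(`abs_scalarCurvatureWith_le_of_curvatureBoundedOn`)).
[cite: Topping2006, proof of Prop. 8.2.6 (Bochner formula under the flow)] -/
theorem IsRicciFlow.bernstein_conjugateHeat_ge {s₀ t₁ : ℝ} (hst : s₀ < t₁)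
    (h : IsRicciFlow g cov (Icc s₀ t₁)) (hR : ∀ r ∈ Icc s₀ t₁, (g r).IsRiemannian)
    {Λ L A : ℝ} (hΛ : 0 ≤ Λ) (hRm : ∀ r ∈ Icc s₀ t₁, CurvatureBoundedBy (g r) (cov r) Λ)
    (hdR : ∀ r ∈ Icc s₀ t₁, ∀ y : M,
      (g r).gradSq (fun z ↦ (g r).scalarCurvatureWith (cov r) z) y ≤ L)
    (hA : 1 + (t₁ - s₀) * (2 * (finrank ℝ E * Λ) + (finrank ℝ E) ^ 2 * Λ) ≤ A)
    {v : ℝ → M → ℝ} (hv : IsConjugateHeatSolutionOn g cov (Icc s₀ t₁) v)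
    {r : ℝ} (hr : r ∈ Icc s₀ t₁) (y : M) :
    -(((t₁ - s₀) ^ 2 * L + 2 * A * ((finrank ℝ E) ^ 2 * Λ)) * (v r y) ^ 2) ≤
      derivWithin (fun r' ↦ (t₁ - r') * (g r').gradSq (v r') y + A * (v r' y) ^ 2) (Icc s₀ t₁) r
        + (g r).laplaceBeltrami (fun z ↦ (t₁ - r) * (g r).gradSq (v r) z + A * (v r z) ^ 2) y := by
  have h2 : (2 : ℕ∞ω) ≤ ∞ := WithTop.coe_le_coe.mpr le_top
  have hS : UniqueDiffOn ℝ (Icc s₀ t₁) := uniqueDiffOn_Icc hst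
  have hVopen : IsOpen (extChartAt I y).target := isOpen_extChartAt_target y
  obtain ⟨hvs, hveq⟩ := hv
  -- (1) the flow read in the chart at `y`
  have hfam := h.isMetricFamilyOn_chartRep_Icc hst y
  have hfl : ∀ r' ∈ Icc s₀ t₁, ∀ z ∈ (extChartAt I y).target,
      MetricCoord.tDeriv (chartRep I g y) (Icc s₀ t₁) r' z =
        (-2 : ℝ) • MetricCoord.ricAt (chartRep I g y r') z := fun r' hr' z hz ↦
    h.tDeriv_chartRep_eq_Icc hst y hr' hz
  -- (2) `v` read in the chart
  set vc : ℝ → E → ℝ := fun r' z ↦ v r' ((extChartAt I y).symm z) with hvc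
  have hvc_smooth : ContDiffOn ℝ ∞ (fun q : E × ℝ ↦ vc q.2 q.1)
      ((extChartAt I y).target ×ˢ Icc s₀ t₁) :=
    contDiffOn_chart_of_contMDiffOn_source_prod (k := (⊤ : ℕ∞)) (w := v) y
      (hvs.mono (prod_mono (subset_univ _) Subset.rfl))
  have hvslice : ∀ r' ∈ Icc s₀ t₁, ContMDiff I 𝓘(ℝ, ℝ) ∞ (v r') := fun r' hr' ↦
    contMDiff_slice_of_contMDiffOn hvs hr'
  have hvct : ∀ r' ∈ Icc s₀ t₁, ContDiffOn ℝ ∞ (vc r') (extChartAt I y).target := fun r' hr' ↦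
    MetricCoord.contDiffOn_of_family hvc_smooth hr'
  have hvc2 : ∀ r' ∈ Icc s₀ t₁, ∀ z : chartTarget I y, ContDiffAt ℝ 2 (vc r') z := fun r' hr' z ↦
    ((hvct r' hr').contDiffAt (hVopen.mem_nhds z.2)).of_le h2
  have hvrep : ∀ r', ∀ z : chartTarget I y, v r' (chartInv I y z) = vc r' z := fun r' z ↦ rfl
  -- (3) the scalar curvature read in the chart at time `r`
  have hGt := hfam.isMetricOn r hr
  set Rc : E → ℝ := MetricCoord.scalAt (chartRep I g y r) with hRc_def
  have hRc : ContDiffOn ℝ ∞ Rc (extChartAt I y).target := hGt.contDiffOn_scalAt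
  have hRrep : ∀ z : chartTarget I y, (g r).scalarCurvatureWith (cov r) (chartInv I y z) = Rc z :=
    fun z ↦ (h.scalAt_chartRep_eq_of_mem y hr z).symm
  -- (4) the conjugate heat equation read in the chart at time `r`, on the chart target
  have hveqc : ∀ z ∈ (extChartAt I y).target,
      MetricCoord.tDerivFun vc (Icc s₀ t₁) r z =
        -MetricCoord.lapAt (chartRep I g y r) (vc r) z + Rc z * vc r z := by
    intro z hz
    have hΔ := lapAt_chartRep_eq g y r ⟨z, hz⟩ (hvrep r) (((hvslice r hr) _).of_le h2)
      (hvc2 r hr ⟨z, hz⟩)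
    rw [MetricCoord.tDerivFun, hΔ, ← hRrep ⟨z, hz⟩]
    exact hveq r hr _
  -- (5) positivity and the curvature bounds at `u₀ = φ y`
  have hy₀ : extChartAt I y y ∈ (extChartAt I y).target := mem_extChartAt_target y
  set u₀ : chartTarget I y := ⟨extChartAt I y y, hy₀⟩ with hu₀def
  have hΦ0 : chartInv I y u₀ = y := extChartAt_to_inv y
  have hposdef : ∀ e : E, e ≠ 0 → 0 < chartRep I g y r (extChartAt I y y) e e := fun e he ↦
    chartRep_posDef g y r (hR r hr) u₀ e he
  have hRic : ∀ e : E, -((finrank ℝ E * Λ) * chartRep I g y r (extChartAt I y y) e e) ≤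
      MetricCoord.ricAt (chartRep I g y r) (extChartAt I y y) e e := by
    intro e
    set X : TangentSpace I ((extChartAt I y).symm (extChartAt I y y)) :=
      (trivializationAt E (TangentSpace I : M → Type _) y).symmL ℝ
        ((extChartAt I y).symm (extChartAt I y y)) e with hX
    have hb := (hRm r hr).abs_ricci_le (hR r hr) _ X
    have h1 := h.ricAt_chartRep_eq_ricci hr y u₀ e e
    rw [show ((u₀ : chartTarget I y) : E) = extChartAt I y y from rfl] at h1
    rw [h1]
    exact (abs_le.mp hb).1
  have hRlo : -((finrank ℝ E : ℝ) ^ 2 * Λ) ≤ Rc (extChartAt I y y) := by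
    have hb := abs_scalarCurvatureWith_le_of_curvatureBoundedOn (hR r hr)
      (curvatureBoundedOn_univ_iff.2 (hRm r hr)) (mem_univ (chartInv I y u₀))
    rw [hRrep u₀] at hb
    exact (abs_le.mp hb).1
  have hDR : MetricCoord.gradSqAt (chartRep I g y r) Rc (extChartAt I y y) ≤ L := by
    have hRsm : ContMDiff I 𝓘(ℝ, ℝ) ∞ (fun z ↦ (g r).scalarCurvatureWith (cov r) z) :=
      (h.isLeviCivita r hr).contMDiff_trace_ricci
    have h' := gradSqAt_chartRep_eq g y r u₀
      (F := fun z ↦ (g r).scalarCurvatureWith (cov r) z) hRrep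
      ((hRsm _).mdifferentiableAt (by simp))
      ((hGt.contDiffAt_scalAt hy₀).differentiableAt (by simp))
    rw [hΦ0] at h'
    rw [show extChartAt I y y = (u₀ : E) from rfl, h']
    exact hdR r hr y
  -- (6) the coordinate inequality at `(φ y, r)`
  have key := hfam.bernstein_conjHeat_ge hfl hvc_smooth hRc hy₀ hr hveqc hposdef
    (CR := finrank ℝ E * Λ) (CS := (finrank ℝ E : ℝ) ^ 2 * Λ) (L := L) (T := t₁ - s₀) (A := A)
    (t₁ := t₁) (by positivity) (by positivity) hRic hRlo hDR hr.2 (by linarith [hr.1]) hA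
  -- (7) transport of each term back to `y`
  -- (a) `|∇v_{r'}|²(y) = gradSqAt (G r') (vc r') (φ y)` for `r' ∈ [s₀, t₁]`
  have hgrad : ∀ r' ∈ Icc s₀ t₁, (g r').gradSq (v r') y =
      MetricCoord.gradSqAt (chartRep I g y r') (vc r') (extChartAt I y y) := by
    intro r' hr'
    have h' := gradSqAt_chartRep_eq g y r' u₀ (hvrep r')
      (((hvslice r' hr') _).mdifferentiableAt (by simp))
      ((hvc2 r' hr' u₀).differentiableAt two_ne_zero)
    rw [hΦ0] at h'
    exact h'.symm
  have hvval : ∀ r', v r' y = vc r' (extChartAt I y y) := fun r' ↦ by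
    rw [← hvrep r' u₀, hΦ0]
  -- (b) the representative of `w_r = |∇v_r|²` and of `G_r` on the chart target
  have hW : ContMDiffOn (I.prod 𝓘(ℝ, ℝ)) 𝓘(ℝ, ℝ) ∞
      (fun p : M × ℝ ↦ (g p.2).gradSq (v p.2) p.1) (univ ×ˢ Icc s₀ t₁) :=
    h.smooth.contMDiffOn_gradSq hS (f := v) hvs
  have hGm : ContMDiffOn (I.prod 𝓘(ℝ, ℝ)) 𝓘(ℝ, ℝ) ∞
      (fun p : M × ℝ ↦ (t₁ - p.2) * (g p.2).gradSq (v p.2) p.1 + A * (v p.2 p.1) ^ 2)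
      (univ ×ˢ Icc s₀ t₁) :=
    ((contMDiffOn_of_time (contDiffOn_const.sub contDiffOn_id)).mul hW).add
      (contMDiffOn_const.mul (hvs.pow 2))
  have hGslice : ContMDiff I 𝓘(ℝ, ℝ) ∞
      (fun z ↦ (t₁ - r) * (g r).gradSq (v r) z + A * (v r z) ^ 2) :=
    contMDiff_slice_of_contMDiffOn
      (u := fun r' z ↦ (t₁ - r') * (g r').gradSq (v r') z + A * (v r' z) ^ 2) hGm hr
  have hWrep : ∀ z : chartTarget I y, (g r).gradSq (v r) (chartInv I y z) =
      MetricCoord.gradSqAt (chartRep I g y r) (vc r) z := fun z ↦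
    (gradSqAt_chartRep_eq g y r z (hvrep r) (((hvslice r hr) _).mdifferentiableAt (by simp))
      ((hvc2 r hr z).differentiableAt two_ne_zero)).symm
  have hGrep : ∀ z : chartTarget I y,
      (fun z' ↦ (t₁ - r) * (g r).gradSq (v r) z' + A * (v r z') ^ 2) (chartInv I y z) =
        (t₁ - r) * MetricCoord.gradSqAt (chartRep I g y r) (vc r) z + A * (vc r z) ^ 2 := by
    intro z
    simp only [hWrep z, hvrep r z]
  have hWc : ContDiffOn ℝ ∞ (MetricCoord.gradSqAt (chartRep I g y r) (vc r))
      (extChartAt I y).target := hGt.contDiffOn_gradSqAt (hvct r hr)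
  have hGc2 : ContDiffAt ℝ 2
      (fun z ↦ (t₁ - r) * MetricCoord.gradSqAt (chartRep I g y r) (vc r) z + A * (vc r z) ^ 2)
      (extChartAt I y y) :=
    (contDiffAt_const.mul (MetricCoord.contDiffAt_two_of_contDiffOn hVopen hWc hy₀)).add
      (contDiffAt_const.mul ((hvc2 r hr u₀).pow 2))
  -- (c) the time derivative
  have e1 : derivWithin (fun r' ↦ (t₁ - r') * (g r').gradSq (v r') y + A * (v r' y) ^ 2)
      (Icc s₀ t₁) r =
      MetricCoord.tDerivFun (fun r' z ↦ (t₁ - r') *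
        MetricCoord.gradSqAt (chartRep I g y r') (vc r') z + A * (vc r' z) ^ 2)
        (Icc s₀ t₁) r (extChartAt I y y) := by
    rw [MetricCoord.tDerivFun]
    refine derivWithin_congr (fun r' hr' ↦ ?_) ?_
    · rw [hgrad r' hr', hvval r']
    · rw [hgrad r hr, hvval r]
  -- (d) the Laplacian
  have e2 : (g r).laplaceBeltrami (fun z ↦ (t₁ - r) * (g r).gradSq (v r) z + A * (v r z) ^ 2) y =
      MetricCoord.lapAt (chartRep I g y r)
        (fun z ↦ (t₁ - r) * MetricCoord.gradSqAt (chartRep I g y r) (vc r) z + A * (vc r z) ^ 2)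
        (extChartAt I y y) := by
    have h' := lapAt_chartRep_eq g y r u₀ hGrep
      (by rw [hΦ0]; exact (hGslice y).of_le h2) hGc2
    rw [hΦ0] at h'
    exact h'.symm
  rw [e1, e2, hvval r]
  exact key

end Pointwise

/-! ## Part C — the backward maximum principle and the interior gradient estimate -/

section GradientEstimate

/-- **Interior (in time) gradient estimate for the conjugate heat equation on a compact Ricci
flow with bounded curvature** (Bernstein–Shi type; the scalar, backward analogue of Shi's first
derivative estimate `F = t|∇Rm|² + A|Rm|²`, Shi 1989, cf. `RicciFlowShiEstimates.lean`; the
a-priori regularity input of the Gaussian bounds for the conjugate heat kernel in the proof of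
Bamler 2020a, Thm. 7.2). For every `m`, `Λ₀, Λ₁ ≥ 0` there is `C = C(m, Λ₀, Λ₁) > 0`
(here `C = A e^{Λ₁ + 2 A m² Λ₀}`, `A = 1 + Λ₀(2m + m²)`) such that: for a Ricci flow of Riemannian
metrics `(h, cov)` on `[s, t₁]`, `s < t₁`, on a closed manifold modelled on `ℝ^m`, with
`|Rm| ≤ Λ` (frame sense) and `|∇R|² ≤ Λ'²` on `M × [s, t₁]`, where `Λ(t₁ − s) ≤ Λ₀` and
`Λ'²(t₁ − s)³ ≤ Λ₁` (scale-invariant smallness), every smooth solution `v` of the conjugate heat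
equation `∂ᵣv = −Δ_{h(r)} v + R v` on `M × [s, t₁]` with `|v| ≤ B` satisfies

  `(t₁ − s) |∇v|²_{h(s)}(y, s) ≤ C B²`   for all `y`.

Proof: `G = (t₁ − r)|∇v|² + A v²` satisfies `(∂ᵣ + Δ)G ≥ −K₁ v² ≥ −K₁ G`,
`K₁ = (t₁ − s)²Λ'² + 2Am²Λ` (`IsRicciFlow.bernstein_conjugateHeat_ge`: Bochner's formula, the
evolution `∂ᵣ|∇v|² = 2Ric(∇v,∇v) + 2⟨∇v, ∇∂ᵣv⟩` of the inverse metric under the flow, `|Ric| ≤ mΛ`,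
`|R| ≤ m²Λ`, Cauchy–Schwarz); the time-reversed function `σ ↦ G(t₁ − σ)` is then a subsolution
of `∂_σ u ≤ Δ_{h(t₁−σ)} u + K₁ u` on `M × [0, t₁ − s]` with `u(·, 0) = A v² ≤ A B²`, so the weak
maximum principle (`weakMaximumPrinciple`, Topping 2006 Thm. 3.1.1, which needs no equation for
the metric family) gives `G(·, s) ≤ A B² e^{K₁(t₁ − s)} ≤ C B²`.
[cite: Topping2006, Thm. 3.1.1 (weak maximum principle) and proof of Prop. 8.2.6 (Bochner)] -/
theorem exists_conjugateHeat_mul_gradSq_le (m : ℕ) {Λ₀ Λ₁ : ℝ} (hΛ₀ : 0 ≤ Λ₀) (_hΛ₁ : 0 ≤ Λ₁) :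
    ∃ C : ℝ, 0 < C ∧ ∀ {H : Type*} [TopologicalSpace H]
      {I : ModelWithCorners ℝ (EuclideanSpace ℝ (Fin m)) H} [I.Boundaryless]
      {M : Type*} [TopologicalSpace M] [ChartedSpace H M] [IsManifold I ∞ M]
      [T2Space M] [CompactSpace M] [SecondCountableTopology M]
      {h : ℝ → PseudoRiemannianMetric I ∞ (EuclideanSpace ℝ (Fin m)) (TangentSpace I : M → Type _)}
      {cov : ℝ → CovariantDerivative I (EuclideanSpace ℝ (Fin m)) (TangentSpace I : M → Type _)}
      {s t₁ : ℝ}, s < t₁ → IsRicciFlow h cov (Icc s t₁) → (∀ r ∈ Icc s t₁, (h r).IsRiemannian) →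
      ∀ {Λ Λ' : ℝ}, 0 ≤ Λ → 0 ≤ Λ' → Λ * (t₁ - s) ≤ Λ₀ → Λ' ^ 2 * (t₁ - s) ^ 3 ≤ Λ₁ →
      (∀ r ∈ Icc s t₁, CurvatureBoundedBy (h r) (cov r) Λ) →
      (∀ r ∈ Icc s t₁, ∀ y : M,
        (h r).gradSq (fun z ↦ (h r).scalarCurvatureWith (cov r) z) y ≤ Λ' ^ 2) →
      ∀ {v : ℝ → M → ℝ}, IsConjugateHeatSolutionOn h cov (Icc s t₁) v →
      ∀ {B : ℝ}, (∀ r ∈ Icc s t₁, ∀ y : M, |v r y| ≤ B) →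
      ∀ y : M, (t₁ - s) * (h s).gradSq (v s) y ≤ C * B ^ 2 := by
  -- the constants `A = 1 + Λ₀(2m + m²)`, `K₀ = Λ₁ + 2 A m² Λ₀`, `C = A e^{K₀}`
  set A : ℝ := 1 + Λ₀ * (2 * m + (m : ℝ) ^ 2) with hA
  set K₀ : ℝ := Λ₁ + 2 * A * ((m : ℝ) ^ 2 * Λ₀) with hK₀
  have hA1 : 1 ≤ A := by
    have h0 : 0 ≤ Λ₀ * (2 * m + (m : ℝ) ^ 2) := by positivity
    linarith
  have hA0 : 0 < A := by linarith
  refine ⟨A * Real.exp K₀, by positivity, ?_⟩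
  intro H _ I _ M _ _ _ _ _ _ h cov s t₁ hst hflow hR Λ Λ' hΛ hΛ' hΛT hΛ'T hRm hdR v hv B hB y
  have hTpos : 0 < t₁ - s := sub_pos.2 hst
  have hfin : (finrank ℝ (EuclideanSpace ℝ (Fin m)) : ℝ) = m := by simp
  -- `A ≥ 1 + T (2mΛ + m²Λ)` since `ΛT ≤ Λ₀`
  have hA' : 1 + (t₁ - s) * (2 * (finrank ℝ (EuclideanSpace ℝ (Fin m)) * Λ) +
      (finrank ℝ (EuclideanSpace ℝ (Fin m)) : ℝ) ^ 2 * Λ) ≤ A := by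
    rw [hfin]
    have h1 : (t₁ - s) * (2 * ((m : ℝ) * Λ) + (m : ℝ) ^ 2 * Λ) =
        (2 * m + (m : ℝ) ^ 2) * (Λ * (t₁ - s)) := by ring
    have h2 := mul_le_mul_of_nonneg_left hΛT (by positivity : (0 : ℝ) ≤ 2 * m + (m : ℝ) ^ 2)
    rw [h1, hA]
    linarith
  -- the reaction constant `K₁`, with `K₁ T ≤ K₀`
  set K₁ : ℝ := (t₁ - s) ^ 2 * Λ' ^ 2 + 2 * A * ((m : ℝ) ^ 2 * Λ) with hK₁
  have hK₁0 : 0 ≤ K₁ := by positivity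
  have hK₁T : K₁ * (t₁ - s) ≤ K₀ := by
    have h3 : 2 * A * (m : ℝ) ^ 2 * (Λ * (t₁ - s)) ≤ 2 * A * (m : ℝ) ^ 2 * Λ₀ :=
      mul_le_mul_of_nonneg_left hΛT (by positivity)
    calc K₁ * (t₁ - s) = Λ' ^ 2 * (t₁ - s) ^ 3 + 2 * A * (m : ℝ) ^ 2 * (Λ * (t₁ - s)) := by
          rw [hK₁]; ring
      _ ≤ Λ₁ + 2 * A * (m : ℝ) ^ 2 * Λ₀ := add_le_add hΛ'T h3
      _ = K₀ := by rw [hK₀]; ring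
  -- the quantity `G = (t₁ − r)|∇v|² + A v²` and its differential inequality (Part B)
  have hG : ∀ r ∈ Icc s t₁, ∀ z : M, -(K₁ * (v r z) ^ 2) ≤
      derivWithin (fun r' ↦ (t₁ - r') * (h r').gradSq (v r') z + A * (v r' z) ^ 2) (Icc s t₁) r
        + (h r).laplaceBeltrami
            (fun z' ↦ (t₁ - r) * (h r).gradSq (v r) z' + A * (v r z') ^ 2) z := by
    intro r hr z
    have h' := hflow.bernstein_conjugateHeat_ge hst hR hΛ hRm hdR hA' hv hr z
    rw [hfin] at h'
    exact h'
  -- `G` is `C^∞` on `M × [s, t₁]`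
  have hS : UniqueDiffOn ℝ (Icc s t₁) := uniqueDiffOn_Icc hst
  have hW := hflow.smooth.contMDiffOn_gradSq hS (f := v) hv.1
  have hGm : ContMDiffOn (I.prod 𝓘(ℝ, ℝ)) 𝓘(ℝ, ℝ) ∞
      (fun p : M × ℝ ↦ (t₁ - p.2) * (h p.2).gradSq (v p.2) p.1 + A * (v p.2 p.1) ^ 2)
      (univ ×ˢ Icc s t₁) :=
    ((contMDiffOn_of_time (contDiffOn_const.sub contDiffOn_id)).mul hW).add
      (contMDiffOn_const.mul (hv.1.pow 2))
  -- the time reversal `σ ↦ t₁ − σ`, `[0, t₁ − s] → [s, t₁]`, and `u(σ) = G(t₁ − σ)`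
  have hmaps : MapsTo (fun σ : ℝ ↦ t₁ - σ) (Icc 0 (t₁ - s)) (Icc s t₁) := by
    intro σ hσ
    exact ⟨by linarith [hσ.2], by linarith [hσ.1]⟩
  have hu : ContMDiffOn (I.prod 𝓘(ℝ, ℝ)) 𝓘(ℝ, ℝ) ∞
      (fun p : M × ℝ ↦ (t₁ - (t₁ - p.2)) * (h (t₁ - p.2)).gradSq (v (t₁ - p.2)) p.1
        + A * (v (t₁ - p.2) p.1) ^ 2) (univ ×ˢ Icc 0 (t₁ - s)) := by
    have hφ : ContMDiff (I.prod 𝓘(ℝ, ℝ)) (I.prod 𝓘(ℝ, ℝ)) ∞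
        (fun p : M × ℝ ↦ (p.1, t₁ - p.2)) :=
      contMDiff_fst.prodMk (contMDiff_const.sub contMDiff_snd)
    exact hGm.comp hφ.contMDiffOn fun p hp ↦ ⟨mem_univ _, hmaps hp.2⟩
  -- `u` is a subsolution of `∂_σ u ≤ Δ_{h(t₁−σ)} u + K₁ u` on `M × [0, t₁ − s]`
  have hineq : ∀ σ ∈ Icc 0 (t₁ - s), ∀ z : M,
      derivWithin (fun σ' ↦ (t₁ - (t₁ - σ')) * (h (t₁ - σ')).gradSq (v (t₁ - σ')) z
          + A * (v (t₁ - σ') z) ^ 2) (Icc 0 (t₁ - s)) σ ≤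
        (h (t₁ - σ)).laplaceBeltrami (fun z' ↦ (t₁ - (t₁ - σ)) *
            (h (t₁ - σ)).gradSq (v (t₁ - σ)) z' + A * (v (t₁ - σ) z') ^ 2) z
          + mvfderiv I (fun z' ↦ (t₁ - (t₁ - σ)) * (h (t₁ - σ)).gradSq (v (t₁ - σ)) z'
              + A * (v (t₁ - σ) z') ^ 2) z (0 : TangentSpace I z)
          + K₁ * ((t₁ - (t₁ - σ)) * (h (t₁ - σ)).gradSq (v (t₁ - σ)) z
              + A * (v (t₁ - σ) z) ^ 2) := by
    intro σ hσ z
    have hr : t₁ - σ ∈ Icc s t₁ := hmaps hσ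
    have hD := hasDerivWithinAt_time_of_contMDiffOn (by simp)
      (u := fun r' z' ↦ (t₁ - r') * (h r').gradSq (v r') z' + A * (v r' z') ^ 2) hGm z hr
    have hrev : HasDerivWithinAt (fun σ' : ℝ ↦ t₁ - σ') (-1) (Icc 0 (t₁ - s)) σ := by
      simpa using (hasDerivWithinAt_id σ (Icc 0 (t₁ - s))).const_sub t₁
    have e : derivWithin (fun σ' ↦ (t₁ - (t₁ - σ')) * (h (t₁ - σ')).gradSq (v (t₁ - σ')) z
        + A * (v (t₁ - σ') z) ^ 2) (Icc 0 (t₁ - s)) σ =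
        derivWithin (fun r' ↦ (t₁ - r') * (h r').gradSq (v r') z + A * (v r' z) ^ 2)
          (Icc s t₁) (t₁ - σ) * (-1) :=
      (hD.comp σ hrev hmaps).derivWithin (uniqueDiffOn_Icc hTpos σ hσ)
    have hGr := hG (t₁ - σ) hr z
    have hv2 : (v (t₁ - σ) z) ^ 2 ≤ (t₁ - (t₁ - σ)) * (h (t₁ - σ)).gradSq (v (t₁ - σ)) z
        + A * (v (t₁ - σ) z) ^ 2 := by
      have hw0 := gradSq_nonneg (h (t₁ - σ)) (hR _ hr) (v (t₁ - σ)) z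
      have h1 : 0 ≤ (t₁ - (t₁ - σ)) * (h (t₁ - σ)).gradSq (v (t₁ - σ)) z :=
        mul_nonneg (by linarith [hσ.1]) hw0
      have h2 : 1 * (v (t₁ - σ) z) ^ 2 ≤ A * (v (t₁ - σ) z) ^ 2 :=
        mul_le_mul_of_nonneg_right hA1 (sq_nonneg _)
      linarith
    have hKv := mul_le_mul_of_nonneg_left hv2 hK₁0
    rw [e, map_zero, add_zero]
    linarith
  -- the comparison function `φ(σ) = A B² e^{K₁ σ}` and the maximum principle
  have hF : ContDiffOn ℝ 1 (uncurry fun (w _ : ℝ) ↦ K₁ * w) (univ ×ˢ Icc 0 (t₁ - s)) :=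
    (contDiff_const.mul contDiff_fst).contDiffOn
  have hφ : ∀ σ ∈ Icc 0 (t₁ - s), HasDerivWithinAt (fun σ' ↦ A * B ^ 2 * Real.exp (K₁ * σ'))
      (K₁ * (A * B ^ 2 * Real.exp (K₁ * σ))) (Icc 0 (t₁ - s)) σ := by
    intro σ _
    have h1 : HasDerivAt (fun σ' ↦ K₁ * σ') K₁ σ := by
      simpa using (hasDerivAt_id σ).const_mul K₁
    refine ((h1.exp.const_mul (A * B ^ 2)).hasDerivWithinAt).congr_deriv ?_
    ring
  have hφ0 : (fun σ' ↦ A * B ^ 2 * Real.exp (K₁ * σ')) 0 = A * B ^ 2 := by simp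
  have hu0 : ∀ z : M, (t₁ - (t₁ - 0)) * (h (t₁ - 0)).gradSq (v (t₁ - 0)) z
      + A * (v (t₁ - 0) z) ^ 2 ≤ A * B ^ 2 := by
    intro z
    have hvB := hB t₁ ⟨hst.le, le_rfl⟩ z
    have hsq : (v t₁ z) ^ 2 ≤ B ^ 2 := sq_le_sq' (abs_le.mp hvB).1 (abs_le.mp hvB).2
    simp only [sub_zero, sub_self, zero_mul, zero_add]
    exact mul_le_mul_of_nonneg_left hsq hA0.le
  have hmax := weakMaximumPrinciple hTpos (g := fun σ ↦ h (t₁ - σ))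
    (fun σ hσ ↦ hR _ (hmaps hσ)) (fun (_ : ℝ) (x : M) ↦ (0 : TangentSpace I x)) hF hu hineq hφ
    hφ0 hu0 (t₁ - s) ⟨hTpos.le, le_rfl⟩ y
  -- read off the estimate at `σ = t₁ − s`, i.e. `r = s`
  have hts : t₁ - (t₁ - s) = s := by ring
  simp only [hts] at hmax
  have hAv : 0 ≤ A * (v s y) ^ 2 := mul_nonneg hA0.le (sq_nonneg _)
  have hexp : Real.exp (K₁ * (t₁ - s)) ≤ Real.exp K₀ := Real.exp_le_exp.2 hK₁T
  have hAB : 0 ≤ A * B ^ 2 := mul_nonneg hA0.le (sq_nonneg _)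
  calc (t₁ - s) * (h s).gradSq (v s) y ≤ A * B ^ 2 * Real.exp (K₁ * (t₁ - s)) := by linarith
    _ ≤ A * B ^ 2 * Real.exp K₀ := mul_le_mul_of_nonneg_left hexp hAB
    _ = A * Real.exp K₀ * B ^ 2 := by ring

end GradientEstimate

end Literature.Geometry.Riemannian
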